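import Summits.Ventures.CertifiedManyBodySolver.Downfold.EmeryVanHoveSubBox
import Summits.Ventures.CertifiedManyBodySolver.Downfold.EmeryVanHoveTableB
import Summits.Ventures.CertifiedManyBodySolver.Downfold.EmeryVanHoveTableC
import Summits.Ventures.CertifiedManyBodySolver.Downfold.EmeryFermiFillingYBCO7Plane
import HarnessLib

/-!
# YBa₂Cu₃O₇ CuO₂ PLANE (box #18Y YBCO7, (K) plane-slice source rows): the CERTIFIED van Hove (Lifshitz) hole doping of the σ three-band model on the typed 3BE one-body box
# — `x_VH ∈ [0.2187, 0.2974]`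

Venture CertifiedManyBodySolver, cell `pub/hubbard-downfold` (stage S1, HUMAN RULINGS D-0096/D-0098: the three-band → one-band reduction error is
carried explicitly), seat hubbard-downfold-mod-4 (technique B = band level); namespace `Summit.Ventures.CertifiedManyBodySolver.Downfold.Emery`.
Everything PROVED; numerics decided by the kernel (ONE `vhBoxCheck` + two entries of the certified table of `Ψ`, `EmeryVanHoveTableB/C`).

DEVICE (`EmeryVanHoveFactorisation` / `EmeryVanHoveSubBox`): the σ-model van Hove hole doping `x_VH = 1 − 2·abFilling(ε_VH)` (the hole count per Cu,
relative to the half-filled antibonding band, at which the Fermi level reaches the saddle point `ε_AB(X)`) FACTORISES as `x_VH = 1 − 2Ψ(q)`,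
`q = u(1 + u)`, **`u = 2(t_pp + t_pp′)/(Δ_pd + ε_VH)`**, with `Ψ` universal and antitone; `u` is monotone in each band parameter, so the window
below is CORNER-EXACT up to the table resolution (±0.005 per side, `K = 384` grid).

THE STATEMENT (`yBCO7PlaneBox_xVH`, typed words `emeryBoxYBCO7planeY6K26Src`). For every parameter vector of the box
Δ_pd [1.75, 2.35] × t_pd [1.17, 1.39] × t_pp [0.61, 0.73] × t_pp′ [0.15, 0.15] (one-body rows of YBa₂Cu₃O₇ CuO₂ PLANE (box #18Y YBCO7, (K) plane-slice source rows)):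
**ε_VH ∈ [1.291, 1.843]** (eV above ε_d), **Δ_pd + ε_VH ∈ [3.193, 4.022]**, **q ∈ [0.5207, 0.8549]**
(i.e. the σ Fermi-surface `−t′/t` AT THE SADDLE ENERGY `ρ = q/(1 + 2q) ∈ [0.2551, 0.3155]`), `x_VH = 1 − 2Ψ(q)`, and
**`x_VH ∈ [0.2187, 0.2974]`** (table entries `Ψ(13/25) ≤ 57603/147456`, `Ψ(171/200) ≥ 51801/147456`).
Float truth at the two extreme corners (not a theorem): x_VH ∈ [0.2242, 0.2922].

READING (the box file's business; comparators are [float]): see the box file addendum / router/EMERY-FS-WINDOWS.md §x_VH.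
WHAT THIS IS NOT: not a statement that the material's parameters ARE in the box (SCREENING-GRADE provenance); `U = 0` band kinematics of the σ
d–p_x–p_y(+t_pp, t_pp′) model; the identification of a material's LIFSHITZ transition with this one-body crossing is the consumer's modelling claim
(correlations and the axial / longer-range one-body channels both move it); no phase sentence. Sources: [HybertsenSchluterChristensen1989, Eq. (1)];
[AndersenEtAl1995, §6]; [PavariniEtAl2001, Eq. (1)].
-/

noncomputable section

namespace Summit.Ventures.CertifiedManyBodySolver.Downfold.Emery

open Real Set
open Summit.Ventures.CertifiedManyBodySolver.Downfold

/-- **YBa₂Cu₃O₇ CuO₂ PLANE (box #18Y YBCO7, (K) plane-slice source rows) — raw-coordinate van Hove certificate**: on Δ_pd [1.75, 2.35] × t_pd [1.17, 1.39] × t_pp [0.61, 0.73] × t_pp′ [0.15, 0.15]: `ε_VH ∈ [1.291, 1.843]`,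
`q ∈ [0.5207, 0.8549]`, `x_VH = 1 − 2Ψ(q)` and `x_VH ∈ [0.2187, 0.2974]`. [folklore] -/
theorem yBCO7PlaneBox_xVH {Δ tpd tpp c : ℝ} (hΔ : Δ ∈ Set.Icc (7 / 4 : ℝ) (47 / 20 : ℝ))
    (ha : tpd ∈ Set.Icc (117 / 100 : ℝ) (139 / 100 : ℝ)) (hb : tpp ∈ Set.Icc (61 / 100 : ℝ) (73 / 100 : ℝ))
    (hc : c ∈ Set.Icc (3 / 20 : ℝ) (3 / 20 : ℝ)) :
    vhEnergy Δ tpd c ∈ Set.Icc (1291 / 1000 : ℝ) (1152 / 625 : ℝ) ∧ vhRatio Δ tpd tpp c ∈ Set.Icc (5207 / 10000 : ℝ) (8549 / 10000 : ℝ) ∧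
      xVH Δ tpd tpp c = 1 - 2 * vhFrac (vhRatio Δ tpd tpp c) ∧ xVH Δ tpd tpp c ∈ Set.Icc (5375 / 24576 : ℝ) (7309 / 24576 : ℝ) := by
  have h := xVH_window_of_vhBoxCheck
    (Δ₁ := ((7 : ℚ) / 4)) (Δ₂ := ((47 : ℚ) / 20)) (a₁ := ((117 : ℚ) / 100)) (a₂ := ((139 : ℚ) / 100)) (b₁ := ((61 : ℚ) / 100)) (b₂ := ((73 : ℚ) / 100))
    (c₁ := ((3 : ℚ) / 20)) (c₂ := ((3 : ℚ) / 20)) (v₁ := ((1291 : ℚ) / 1000)) (v₂ := ((1152 : ℚ) / 625)) (e := ((7217 : ℚ) / 5000)) (E := ((16721 : ℚ) / 10000))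
    (q₁ := ((5207 : ℚ) / 10000)) (q₂ := ((8549 : ℚ) / 10000)) (by decide +kernel)
    (Δ := Δ) (tpd := tpd) (tpp := tpp) (c := c) (by simpa using hΔ) (by simpa using ha) (by simpa using hb) (by simpa using hc)
  obtain ⟨hv, -, hq, -, heq, hwin⟩ := h
  push_cast at hv hq hwin
  have hx := xVH_window_of_table hwin (qa := (13 / 25 : ℝ)) (qb := (171 / 200 : ℝ)) (by norm_num) (by norm_num) vhFrac_13_25.2 vhFrac_171_200.1
  exact ⟨⟨by linarith [hv.1], by linarith [hv.2]⟩, ⟨by linarith [hq.1], by linarith [hq.2]⟩, heq,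
    ⟨by linarith [hx.1], by linarith [hx.2]⟩⟩

/-- **THE WORD ON THE TYPED BOX `emeryBoxYBCO7planeY6K26Src`**: at every parameter vector the σ three-band van Hove (Lifshitz) hole doping lies in
`[0.2187, 0.2974]` (holes per Cu relative to the half-filled antibonding band). [cite: HybertsenSchluterChristensen1989, Eq. (1) (three-band d–p model)] -/
theorem emeryBoxYBCO7planeY6K26Src_xVH_window :
    HoldsOn (fun p : EmeryCoord → ℝ =>
      xVH (p .DeltaPd) (p .tpd) (p .tpp) (p .tppP) ∈ Set.Icc (5375 / 24576 : ℝ) (7309 / 24576 : ℝ)) emeryBoxYBCO7planeY6K26Src := by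
  intro p hp
  obtain ⟨hΔ, ha, hb, hc, -⟩ := emeryBoxYBCO7planeY6K26Src_mem_rows hp
  exact (yBCO7PlaneBox_xVH hΔ ha hb hc).2.2.2

/-- On `emeryBoxYBCO7planeY6K26Src`: the saddle energy `ε_VH ∈ [1.291, 1.843]` and the ratio `q ∈ [0.5207, 0.8549]` (`−t′/t` at the saddle energy
`∈ [0.2551, 0.3155]`). [folklore] -/
theorem emeryBoxYBCO7planeY6K26Src_vhEnergy_vhRatio_window :
    HoldsOn (fun p : EmeryCoord → ℝ =>
      vhEnergy (p .DeltaPd) (p .tpd) (p .tppP) ∈ Set.Icc (1291 / 1000 : ℝ) (1152 / 625 : ℝ) ∧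
      vhRatio (p .DeltaPd) (p .tpd) (p .tpp) (p .tppP) ∈ Set.Icc (5207 / 10000 : ℝ) (8549 / 10000 : ℝ)) emeryBoxYBCO7planeY6K26Src := by
  intro p hp
  obtain ⟨hΔ, ha, hb, hc, -⟩ := emeryBoxYBCO7planeY6K26Src_mem_rows hp
  exact (yBCO7PlaneBox_xVH hΔ ha hb hc)|> fun h => ⟨h.1, h.2.1⟩

end Summit.Ventures.CertifiedManyBodySolver.Downfold.Emery
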